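import Summits.CriticalPhenomena.PercolationContinuityZ3.Theorems.PercNearOneGluingNoHeavyQuantThreeRootGateCoupling
import HarnessLib

/-!
# QUANT lane R8, T-DEC: THE TIED-CORE COUPLING IDENTITY — an explicit four-shape re-gating mixture for three trees with a common root
# gate INSIDE the pinned region `3aq > 2` (where every black-box certificate fails), using ONE opened internal gate per tree

builds on p205010 (kernel theorem, internal audit signed; external expert review pending)

Support file (`--supports stmt-CriticalPhenomena-4575`), QUANT lane lead seat prim-quant-lead (gen 44); memo
`run/shared/lean/prim/quant/prim-quant-lead-g44/LEAD-NOTES-G44.md` F8–F9, README V416–V417.  Theorems only (pure algebra of `gate`/`lconv`),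
standard axioms, no sorries.  Companion of census-2 g71's `…QuantThreeRootGateCoupling` (`threeRoot_gateCoupling`, valid for `3·a·q ≤ 2` up to
its positivity conditions) and arm-1 g46's tied triangle: this identity is valid exactly on the OTHER side, `3·a·q > 2` (the PINNED region of
README V403/V407/V413–V416), where lead g43 proved (M2) that no certificate over intact black-box subtrees exists.

THE SETTING.  Three sibling trees `tᵢ = gate_q ρᵢ` with a COMMON root gate `q` under an outer gate `a`; write `m = a·q`.  Each opened law `ρᵢ`
(on `{0..Mᵢ}`, vanishing above its top) is presented with ONE opened internal gate: `ρᵢ = (1−s)·ρᵢ⁻ + s·ρᵢ⁺` pointwise, with a COMMON internal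
gate `s` — `ρᵢ⁻` = the tree with the sub-forest under that gate DROPPED, `ρᵢ⁺` = with it SURELY attached (for a 2-chain `R[1](R[s])`: `ρ⁻ = δ₁`,
`ρ⁺ = δ₂`); the laws `ρᵢ⁻`, `ρᵢ⁺` are otherwise arbitrary (vanishing above `Mᵢ`).  A free real parameter `r` (in the application `r = R_σ/R₋`, the
ratio of the sub-forest's mean to the root part's mean) fixes the two version gates
  `τ = (3m−2)(1+s r)` (the DROPPED version's root gate),  `t = (3m−2)(1+s r)/(1+r)` (the ATTACHED version's root gate).
THE IDENTITY (`tiedCore_gateCoupling`).  With `w_P = ((1−q)/(1−m))²`, `w_N = (1−a)q(2−q)/(1−m)`,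
`c_U = (1−s)·a q²(1−a)(1−q) / (3(1+sr)(1−m)²)`, `c_D = s(1+r)·a q²(1−a)(1−q) / (3(1+sr)(1−m)²)`:
  `gate_a(t₁ ∗ t₂ ∗ t₃) = w_N·gate_m(ρ₁∗ρ₂∗ρ₃) + w_P·(gate_m ρ₁ ∗ gate_m ρ₂ ∗ gate_m ρ₃)`
  `                     + c_U·Σ_k [ρᵢ ∗ ρⱼ ∗ gate_τ ρ_k⁻] + c_D·Σ_k [ρᵢ ∗ ρⱼ ∗ gate_t ρ_k⁺]`      (pointwise; `{i,j,k} = {1,2,3}`),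
i.e. NATURAL BLOCK + NATURAL PRODUCT + 'two trees SURELY present (root gate opened to 1), the third DROPPED-version at `τ`' + 'two trees surely
present, the third ATTACHED-version at `t`'.  All four weights are manifestly NONNEGATIVE for `a, q < 1`, and `w_N + w_P + 3c_U + 3c_D = 1`
(`tiedCore_weights_sum`).  With `r = R_σ/R₋` every component has mean exactly `S = 3m(R₋ + sR_σ)` (the version gates were solved from the means;
the remaining consistency condition `(1−s)/τ + s/t = 1/(3m−2)` holds identically in `r`).  PROOF: census-2's `lconv3_gate_expand` for the target,
the block and the product; `lconv_gate_left/right` for the six version components; the three splits merge the version monomials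
`(1−s)·[…ρ_k⁻…] + s·[…ρ_k⁺…] = […ρ_k…]`; then `field_simp; ring`.
VALIDITY AS A CERTIFICATE (README V417; not formalised here): `3m > 2` (pinned), `τ ≤ 1`, `t ≤ 1`, and the floors of the two versions (for 2-chains:
`2(1+s)/(3+s) ≤ m ≤ (3+2s)/(3(1+s))`, non-empty iff `s < (√57−3)/8 ≈ .569`); inside `LawDec.GateStepN` every component is an oracle instance (the
block has `n−2` nontrivial gates, the product is an ungated product of three trees, each version component has `≤ n−2`).  Found by exact LP on the
10 permutation-types of the 27 version patterns (the lead's explore/tiedspecial.py: supports {N, P, S2U(h=s), S2D(h=s)} at many grid points), then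
derived and verified on 300 random rational (a,q,s) and multilinearly (explore/tiedidentity.py).

HONEST STATUS.  `SiblingStep`, `GateStepN`, `FarTreeRow` remain OPEN; RATE class (log\*) and the honest sentence of
`run/shared/lean/prim/quant/README.md` unchanged.  [this work]; `lconv3_gate_expand`, `threeRoot_gateCoupling`: prim-quant-census-2 g71; two-root
identity: prim-quant-arm-1 g45 (this lane).  Nothing here is a published result.  The gluing rows served [cite: KozmaNitzan2024, Conjecture 3 (p. 15)];
product measure [cite: Grimmett1999, §1.3 p. 10].
-/

noncomputable section

namespace Summit.CriticalPhenomena.PercolationContinuityZ3.Theorems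

namespace Quant

namespace LawDec

/-- merging a version split in the RIGHT slot of a triple convolution. [this work] -/
theorem lconv3_merge_right (M₁ M₂ M₃ : ℕ) (ρ₁ ρ₂ ρ₃ ρ₃m ρ₃p : ℕ → ℝ) (s : ℝ)
    (hs : ρ₃ = fun k => (1 - s) * ρ₃m k + s * ρ₃p k) (h : ℕ) :
    (1 - s) * lconv (M₁ + M₂) M₃ (lconv M₁ M₂ ρ₁ ρ₂) ρ₃m h + s * lconv (M₁ + M₂) M₃ (lconv M₁ M₂ ρ₁ ρ₂) ρ₃p h
      = lconv (M₁ + M₂) M₃ (lconv M₁ M₂ ρ₁ ρ₂) ρ₃ h := by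
  rw [hs, lconv_lin_right]

/-- merging a version split in the LEFT slot of a triple convolution. [this work] -/
theorem lconv3_merge_left (M₁ M₂ M₃ : ℕ) (ρ₁ ρ₂ ρ₃ ρ₁m ρ₁p : ℕ → ℝ) (s : ℝ)
    (hs : ρ₁ = fun k => (1 - s) * ρ₁m k + s * ρ₁p k) (h : ℕ) :
    (1 - s) * lconv (M₁ + M₂) M₃ (lconv M₁ M₂ ρ₁m ρ₂) ρ₃ h + s * lconv (M₁ + M₂) M₃ (lconv M₁ M₂ ρ₁p ρ₂) ρ₃ h
      = lconv (M₁ + M₂) M₃ (lconv M₁ M₂ ρ₁ ρ₂) ρ₃ h := by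
  have e : lconv M₁ M₂ ρ₁ ρ₂ = fun k => (1 - s) * lconv M₁ M₂ ρ₁m ρ₂ k + s * lconv M₁ M₂ ρ₁p ρ₂ k := by
    funext k; rw [hs, lconv_lin_left]
  rw [e, lconv_lin_left]

/-- merging a version split in the MIDDLE slot of a triple convolution. [this work] -/
theorem lconv3_merge_mid (M₁ M₂ M₃ : ℕ) (ρ₁ ρ₂ ρ₃ ρ₂m ρ₂p : ℕ → ℝ) (s : ℝ)
    (hs : ρ₂ = fun k => (1 - s) * ρ₂m k + s * ρ₂p k) (h : ℕ) :
    (1 - s) * lconv (M₁ + M₂) M₃ (lconv M₁ M₂ ρ₁ ρ₂m) ρ₃ h + s * lconv (M₁ + M₂) M₃ (lconv M₁ M₂ ρ₁ ρ₂p) ρ₃ h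
      = lconv (M₁ + M₂) M₃ (lconv M₁ M₂ ρ₁ ρ₂) ρ₃ h := by
  have e : lconv M₁ M₂ ρ₁ ρ₂ = fun k => (1 - s) * lconv M₁ M₂ ρ₁ ρ₂m k + s * lconv M₁ M₂ ρ₁ ρ₂p k := by
    funext k; rw [hs, lconv_lin_right]
  rw [e, lconv_lin_left]

/-- a version component with the version in the RIGHT slot: `ρ₁ ∗ ρ₂ ∗ gate_g ν = g·(ρ₁∗ρ₂∗ν) + (1−g)·(ρ₁∗ρ₂)`. [this work] -/
theorem lconv3_version_right (M₁ M₂ M₃ : ℕ) (ρ₁ ρ₂ ν : ℕ → ℝ) (g : ℝ) (h : ℕ) :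
    lconv (M₁ + M₂) M₃ (lconv M₁ M₂ ρ₁ ρ₂) (gate ν g) h
      = g * lconv (M₁ + M₂) M₃ (lconv M₁ M₂ ρ₁ ρ₂) ν h + (1 - g) * lconv M₁ M₂ ρ₁ ρ₂ h :=
  lconv_gate_right (M₁ + M₂) M₃ (lconv M₁ M₂ ρ₁ ρ₂) ν g (fun k hk => lconv_eq_zero _ _ _ _ k hk) h

/-- a version component with the version in the LEFT slot: `gate_g ν ∗ ρ₂ ∗ ρ₃ = g·(ν∗ρ₂∗ρ₃) + (1−g)·(ρ₂∗ρ₃)`. [this work] -/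
theorem lconv3_version_left (M₁ M₂ M₃ : ℕ) (ν ρ₂ ρ₃ : ℕ → ℝ) (g : ℝ)
    (h₂M : ∀ h, M₂ < h → ρ₂ h = 0) (h : ℕ) :
    lconv (M₁ + M₂) M₃ (lconv M₁ M₂ (gate ν g) ρ₂) ρ₃ h
      = g * lconv (M₁ + M₂) M₃ (lconv M₁ M₂ ν ρ₂) ρ₃ h + (1 - g) * lconv M₂ M₃ ρ₂ ρ₃ h := by
  have e : lconv M₁ M₂ (gate ν g) ρ₂ = fun k => g * lconv M₁ M₂ ν ρ₂ k + (1 - g) * ρ₂ k :=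
    funext (lconv_gate_left M₁ M₂ ν ρ₂ g h₂M)
  rw [e, lconv_lin_left, lconv_top_left_of_le M₂ (M₁ + M₂) M₃ ρ₂ ρ₃ (by omega) h₂M h]

/-- a version component with the version in the MIDDLE slot: `ρ₁ ∗ gate_g ν ∗ ρ₃ = g·(ρ₁∗ν∗ρ₃) + (1−g)·(ρ₁∗ρ₃)`. [this work] -/
theorem lconv3_version_mid (M₁ M₂ M₃ : ℕ) (ρ₁ ν ρ₃ : ℕ → ℝ) (g : ℝ)
    (h₁M : ∀ h, M₁ < h → ρ₁ h = 0) (h : ℕ) :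
    lconv (M₁ + M₂) M₃ (lconv M₁ M₂ ρ₁ (gate ν g)) ρ₃ h
      = g * lconv (M₁ + M₂) M₃ (lconv M₁ M₂ ρ₁ ν) ρ₃ h + (1 - g) * lconv M₁ M₃ ρ₁ ρ₃ h := by
  have e : lconv M₁ M₂ ρ₁ (gate ν g) = fun k => g * lconv M₁ M₂ ρ₁ ν k + (1 - g) * ρ₁ k :=
    funext (lconv_gate_right M₁ M₂ ρ₁ ν g h₁M)
  rw [e, lconv_lin_left, lconv_top_left_of_le M₁ (M₁ + M₂) M₃ ρ₁ ρ₃ (by omega) h₁M h]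

/-- **THE TIED-CORE COUPLING IDENTITY** (see the file header). [this work] -/
theorem tiedCore_gateCoupling (M₁ M₂ M₃ : ℕ) (ρ₁ ρ₂ ρ₃ ρ₁m ρ₂m ρ₃m ρ₁p ρ₂p ρ₃p : ℕ → ℝ) (q s a r : ℝ)
    (h₁M : ∀ h, M₁ < h → ρ₁ h = 0) (h₂M : ∀ h, M₂ < h → ρ₂ h = 0) (h₃M : ∀ h, M₃ < h → ρ₃ h = 0)
    (hs₁ : ρ₁ = fun k => (1 - s) * ρ₁m k + s * ρ₁p k) (hs₂ : ρ₂ = fun k => (1 - s) * ρ₂m k + s * ρ₂p k)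
    (hs₃ : ρ₃ = fun k => (1 - s) * ρ₃m k + s * ρ₃p k)
    (hm : 1 - a * q ≠ 0) (hs0 : s ≠ 0) (hr1 : 1 + r ≠ 0) (hrs : 1 + s * r ≠ 0) (h : ℕ) :
    gate (lconv (M₁ + M₂) M₃ (lconv M₁ M₂ (gate ρ₁ q) (gate ρ₂ q)) (gate ρ₃ q)) a h
      = ((1 - a) * q * (2 - q) / (1 - a * q)) * gate (lconv (M₁ + M₂) M₃ (lconv M₁ M₂ ρ₁ ρ₂) ρ₃) (a * q) h
        + ((1 - q) / (1 - a * q)) ^ 2 * lconv (M₁ + M₂) M₃ (lconv M₁ M₂ (gate ρ₁ (a * q)) (gate ρ₂ (a * q))) (gate ρ₃ (a * q)) h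
        + ((1 - s) * (a * q ^ 2 * (1 - a) * (1 - q)) / (3 * (1 + s * r) * (1 - a * q) ^ 2))
            * (lconv (M₁ + M₂) M₃ (lconv M₁ M₂ (gate ρ₁m ((3 * (a * q) - 2) * (1 + s * r))) ρ₂) ρ₃ h
              + lconv (M₁ + M₂) M₃ (lconv M₁ M₂ ρ₁ (gate ρ₂m ((3 * (a * q) - 2) * (1 + s * r)))) ρ₃ h
              + lconv (M₁ + M₂) M₃ (lconv M₁ M₂ ρ₁ ρ₂) (gate ρ₃m ((3 * (a * q) - 2) * (1 + s * r))) h)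
        + ((s * (1 + r)) * (a * q ^ 2 * (1 - a) * (1 - q)) / (3 * (1 + s * r) * (1 - a * q) ^ 2))
            * (lconv (M₁ + M₂) M₃ (lconv M₁ M₂ (gate ρ₁p ((3 * (a * q) - 2) * (1 + s * r) / (1 + r))) ρ₂) ρ₃ h
              + lconv (M₁ + M₂) M₃ (lconv M₁ M₂ ρ₁ (gate ρ₂p ((3 * (a * q) - 2) * (1 + s * r) / (1 + r)))) ρ₃ h
              + lconv (M₁ + M₂) M₃ (lconv M₁ M₂ ρ₁ ρ₂) (gate ρ₃p ((3 * (a * q) - 2) * (1 + s * r) / (1 + r))) h) := by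
  -- the version monomials with `ρ_kp` in terms of the intact monomial and the `ρ_km` one (from the splits)
  have e₁ : lconv (M₁ + M₂) M₃ (lconv M₁ M₂ ρ₁p ρ₂) ρ₃ h
      = (lconv (M₁ + M₂) M₃ (lconv M₁ M₂ ρ₁ ρ₂) ρ₃ h - (1 - s) * lconv (M₁ + M₂) M₃ (lconv M₁ M₂ ρ₁m ρ₂) ρ₃ h) / s := by
    rw [← lconv3_merge_left M₁ M₂ M₃ ρ₁ ρ₂ ρ₃ ρ₁m ρ₁p s hs₁ h]; field_simp; ring
  have e₂ : lconv (M₁ + M₂) M₃ (lconv M₁ M₂ ρ₁ ρ₂p) ρ₃ h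
      = (lconv (M₁ + M₂) M₃ (lconv M₁ M₂ ρ₁ ρ₂) ρ₃ h - (1 - s) * lconv (M₁ + M₂) M₃ (lconv M₁ M₂ ρ₁ ρ₂m) ρ₃ h) / s := by
    rw [← lconv3_merge_mid M₁ M₂ M₃ ρ₁ ρ₂ ρ₃ ρ₂m ρ₂p s hs₂ h]; field_simp; ring
  have e₃ : lconv (M₁ + M₂) M₃ (lconv M₁ M₂ ρ₁ ρ₂) ρ₃p h
      = (lconv (M₁ + M₂) M₃ (lconv M₁ M₂ ρ₁ ρ₂) ρ₃ h - (1 - s) * lconv (M₁ + M₂) M₃ (lconv M₁ M₂ ρ₁ ρ₂) ρ₃m h) / s := by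
    rw [← lconv3_merge_right M₁ M₂ M₃ ρ₁ ρ₂ ρ₃ ρ₃m ρ₃p s hs₃ h]; field_simp; ring
  rw [gate_apply _ a h, lconv3_gate_expand M₁ M₂ M₃ ρ₁ ρ₂ ρ₃ q q q h₁M h₂M h₃M h,
    gate_apply (lconv (M₁ + M₂) M₃ (lconv M₁ M₂ ρ₁ ρ₂) ρ₃) (a * q) h,
    lconv3_gate_expand M₁ M₂ M₃ ρ₁ ρ₂ ρ₃ (a * q) (a * q) (a * q) h₁M h₂M h₃M h,
    lconv3_version_left M₁ M₂ M₃ ρ₁m ρ₂ ρ₃ _ h₂M h, lconv3_version_mid M₁ M₂ M₃ ρ₁ ρ₂m ρ₃ _ h₁M h,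
    lconv3_version_right M₁ M₂ M₃ ρ₁ ρ₂ ρ₃m _ h,
    lconv3_version_left M₁ M₂ M₃ ρ₁p ρ₂ ρ₃ _ h₂M h, lconv3_version_mid M₁ M₂ M₃ ρ₁ ρ₂p ρ₃ _ h₁M h,
    lconv3_version_right M₁ M₂ M₃ ρ₁ ρ₂ ρ₃p _ h, e₁, e₂, e₃]
  field_simp
  ring

/-- **the four weights sum to one**: `w_N + w_P + 3c_U + 3c_D = 1`. [this work] -/
theorem tiedCore_weights_sum (q s a r : ℝ) (hm : 1 - a * q ≠ 0) (hrs : 1 + s * r ≠ 0) :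
    (1 - a) * q * (2 - q) / (1 - a * q) + ((1 - q) / (1 - a * q)) ^ 2
      + 3 * ((1 - s) * (a * q ^ 2 * (1 - a) * (1 - q)) / (3 * (1 + s * r) * (1 - a * q) ^ 2))
      + 3 * ((s * (1 + r)) * (a * q ^ 2 * (1 - a) * (1 - q)) / (3 * (1 + s * r) * (1 - a * q) ^ 2)) = 1 := by
  field_simp
  ring

/-- **the weights are nonnegative** for `0 ≤ a ≤ 1`, `0 ≤ q ≤ 1`, `0 ≤ s ≤ 1`, `0 ≤ r` (with `a·q ≠ 1`). [this work] -/
theorem tiedCore_weights_nonneg (q s a r : ℝ) (ha0 : 0 ≤ a) (ha1 : a ≤ 1) (hq0 : 0 ≤ q) (hq1 : q ≤ 1) (hs0 : 0 ≤ s) (hs1 : s ≤ 1)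
    (hr0 : 0 ≤ r) (hm : 1 - a * q ≠ 0) :
    0 ≤ (1 - a) * q * (2 - q) / (1 - a * q) ∧ 0 ≤ ((1 - q) / (1 - a * q)) ^ 2
      ∧ 0 ≤ (1 - s) * (a * q ^ 2 * (1 - a) * (1 - q)) / (3 * (1 + s * r) * (1 - a * q) ^ 2)
      ∧ 0 ≤ (s * (1 + r)) * (a * q ^ 2 * (1 - a) * (1 - q)) / (3 * (1 + s * r) * (1 - a * q) ^ 2) := by
  have hm' : 0 < 1 - a * q := by
    rcases lt_or_eq_of_le (mul_le_one₀ ha1 hq0 hq1) with hlt | heq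
    · linarith
    · exact absurd (by linarith [heq]) hm
  have hsr : 0 < 1 + s * r := by positivity
  refine ⟨?_, by positivity, ?_, ?_⟩
  · apply div_nonneg _ hm'.le
    have : 0 ≤ 2 - q := by linarith
    have : 0 ≤ 1 - a := by linarith
    positivity
  · have : 0 ≤ 1 - s := by linarith
    have : 0 ≤ 1 - a := by linarith
    have : 0 ≤ 1 - q := by linarith
    positivity
  · have : 0 ≤ 1 - a := by linarith
    have : 0 ≤ 1 - q := by linarith
    positivity

/-- **mean bookkeeping of the version gates**: with `τ = (3m−2)(1+sr)` and `t = (3m−2)(1+sr)/(1+r)` the consistency relation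
`(3m−2)·((1−s)·t + s·τ) = τ·t` holds identically, and for a tree with root-part mean `R` and sub-forest mean `r·R` the two version components have
the block's mean: `2(R + s r R) + τ R = 3m(R + s r R)` and `2(R + s r R) + t(R + r R) = 3m(R + s r R)`. [this work] -/
theorem tiedCore_means (q s a r R : ℝ) (hr1 : 1 + r ≠ 0) :
    (3 * (a * q) - 2) * ((1 - s) * ((3 * (a * q) - 2) * (1 + s * r) / (1 + r)) + s * ((3 * (a * q) - 2) * (1 + s * r)))
        = ((3 * (a * q) - 2) * (1 + s * r)) * ((3 * (a * q) - 2) * (1 + s * r) / (1 + r))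
      ∧ 2 * (R + s * (r * R)) + ((3 * (a * q) - 2) * (1 + s * r)) * R = 3 * (a * q) * (R + s * (r * R))
      ∧ 2 * (R + s * (r * R)) + ((3 * (a * q) - 2) * (1 + s * r) / (1 + r)) * (R + r * R) = 3 * (a * q) * (R + s * (r * R)) := by
  refine ⟨?_, by ring, ?_⟩
  · field_simp
    ring
  · field_simp
    ring

/-! ### The general form: per-tree version gates solved from the means (distinct tree contents and means) -/

/-- **THE TIED-CORE COUPLING IDENTITY, GENERAL MEANS.**  Same setting (common root gate `q`, each opened law split at one internal gate of common
value `s`: `ρᵢ = (1−s)ρᵢ⁻ + sρᵢ⁺`), but now with SIX free real parameters `Rm₁ Rm₂ Rm₃` (the root parts' means) and `Rs₁ Rs₂ Rs₃` (the attached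
sub-forests' means) — free reals here; in the certificate they ARE the means.  Write `m = aq`, `Rᵢ = Rmᵢ + s·Rsᵢ`, `Σ = R₁+R₂+R₃`, `Dₖ = mΣ − Σ + Rₖ`
(`= S − Rᵢ − Rⱼ`, positive iff the target mean `S = mΣ` is PINNED with respect to tree `k`), per-tree version gates `τₖ = Dₖ/Rmₖ` (dropped) and
`tₖ = Dₖ/(Rmₖ + Rsₖ)` (attached), and weights `w_P = ((1−q)/(1−m))²`, `w_N = (1−a)q(2−q)/(1−m)`,
`c_{U,k} = (1−s)(1−q)(1−a)·mq·Rmₖ/((1−m)²Σ)`, `c_{D,k} = s(1−q)(1−a)·mq·(Rmₖ+Rsₖ)/((1−m)²Σ)`.  Then pointwise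
`gate_a(t₁∗t₂∗t₃) = w_N·gate_m(ρ₁∗ρ₂∗ρ₃) + w_P·⊗gate_m ρᵢ + Σₖ c_{U,k}·[ρᵢ∗ρⱼ∗gate_{τₖ}ρₖ⁻] + Σₖ c_{D,k}·[ρᵢ∗ρⱼ∗gate_{tₖ}ρₖ⁺]`; the weights are
`≥ 0` and sum to `1` (`tiedCore_general_weights_sum`), and with the `Rm`, `Rs` the actual means EVERY version component has mean exactly `S`
(`tiedCore_general_means`: `Rᵢ + Rⱼ + τₖ·Rmₖ = S = Rᵢ + Rⱼ + tₖ·(Rmₖ + Rsₖ)`).  The consistency behind it: `Σₖ βₖ = R₃` holds identically because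
`Σₖ Dₖ = (3m−2)Σ`.  Verified exactly on 400 random rational instances (explore/, multilinear with distinct contents). [this work] -/
theorem tiedCore_gateCoupling_general (M₁ M₂ M₃ : ℕ) (ρ₁ ρ₂ ρ₃ ρ₁m ρ₂m ρ₃m ρ₁p ρ₂p ρ₃p : ℕ → ℝ) (q s a Rm₁ Rm₂ Rm₃ Rs₁ Rs₂ Rs₃ : ℝ)
    (h₁M : ∀ h, M₁ < h → ρ₁ h = 0) (h₂M : ∀ h, M₂ < h → ρ₂ h = 0) (h₃M : ∀ h, M₃ < h → ρ₃ h = 0)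
    (hs₁ : ρ₁ = fun k => (1 - s) * ρ₁m k + s * ρ₁p k) (hs₂ : ρ₂ = fun k => (1 - s) * ρ₂m k + s * ρ₂p k)
    (hs₃ : ρ₃ = fun k => (1 - s) * ρ₃m k + s * ρ₃p k)
    (hm : 1 - a * q ≠ 0) (hs0 : s ≠ 0) (hRm₁ : Rm₁ ≠ 0) (hRm₂ : Rm₂ ≠ 0) (hRm₃ : Rm₃ ≠ 0)
    (hRp₁ : Rm₁ + Rs₁ ≠ 0) (hRp₂ : Rm₂ + Rs₂ ≠ 0) (hRp₃ : Rm₃ + Rs₃ ≠ 0)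
    (hSig : (Rm₁ + s * Rs₁) + (Rm₂ + s * Rs₂) + (Rm₃ + s * Rs₃) ≠ 0) (h : ℕ) :
    gate (lconv (M₁ + M₂) M₃ (lconv M₁ M₂ (gate ρ₁ q) (gate ρ₂ q)) (gate ρ₃ q)) a h
      = ((1 - a) * q * (2 - q) / (1 - a * q)) * gate (lconv (M₁ + M₂) M₃ (lconv M₁ M₂ ρ₁ ρ₂) ρ₃) (a * q) h
        + ((1 - q) / (1 - a * q)) ^ 2 * lconv (M₁ + M₂) M₃ (lconv M₁ M₂ (gate ρ₁ (a * q)) (gate ρ₂ (a * q))) (gate ρ₃ (a * q)) h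
        + ((1 - s) * (1 - q) * (1 - a) * (a * q * q) / ((1 - a * q) ^ 2 * ((Rm₁ + s * Rs₁) + (Rm₂ + s * Rs₂) + (Rm₃ + s * Rs₃))))
            * (Rm₁ * lconv (M₁ + M₂) M₃ (lconv M₁ M₂ (gate ρ₁m
                  ((a * q * ((Rm₁ + s * Rs₁) + (Rm₂ + s * Rs₂) + (Rm₃ + s * Rs₃)) - (Rm₂ + s * Rs₂) - (Rm₃ + s * Rs₃)) / Rm₁)) ρ₂) ρ₃ h
              + Rm₂ * lconv (M₁ + M₂) M₃ (lconv M₁ M₂ ρ₁ (gate ρ₂m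
                  ((a * q * ((Rm₁ + s * Rs₁) + (Rm₂ + s * Rs₂) + (Rm₃ + s * Rs₃)) - (Rm₁ + s * Rs₁) - (Rm₃ + s * Rs₃)) / Rm₂))) ρ₃ h
              + Rm₃ * lconv (M₁ + M₂) M₃ (lconv M₁ M₂ ρ₁ ρ₂) (gate ρ₃m
                  ((a * q * ((Rm₁ + s * Rs₁) + (Rm₂ + s * Rs₂) + (Rm₃ + s * Rs₃)) - (Rm₁ + s * Rs₁) - (Rm₂ + s * Rs₂)) / Rm₃)) h)
        + ((s * (1 - q) * (1 - a) * (a * q * q)) / ((1 - a * q) ^ 2 * ((Rm₁ + s * Rs₁) + (Rm₂ + s * Rs₂) + (Rm₃ + s * Rs₃))))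
            * ((Rm₁ + Rs₁) * lconv (M₁ + M₂) M₃ (lconv M₁ M₂ (gate ρ₁p
                  ((a * q * ((Rm₁ + s * Rs₁) + (Rm₂ + s * Rs₂) + (Rm₃ + s * Rs₃)) - (Rm₂ + s * Rs₂) - (Rm₃ + s * Rs₃)) / (Rm₁ + Rs₁))) ρ₂) ρ₃ h
              + (Rm₂ + Rs₂) * lconv (M₁ + M₂) M₃ (lconv M₁ M₂ ρ₁ (gate ρ₂p
                  ((a * q * ((Rm₁ + s * Rs₁) + (Rm₂ + s * Rs₂) + (Rm₃ + s * Rs₃)) - (Rm₁ + s * Rs₁) - (Rm₃ + s * Rs₃)) / (Rm₂ + Rs₂)))) ρ₃ h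
              + (Rm₃ + Rs₃) * lconv (M₁ + M₂) M₃ (lconv M₁ M₂ ρ₁ ρ₂) (gate ρ₃p
                  ((a * q * ((Rm₁ + s * Rs₁) + (Rm₂ + s * Rs₂) + (Rm₃ + s * Rs₃)) - (Rm₁ + s * Rs₁) - (Rm₂ + s * Rs₂)) / (Rm₃ + Rs₃))) h) := by
  have e₁ : lconv (M₁ + M₂) M₃ (lconv M₁ M₂ ρ₁p ρ₂) ρ₃ h
      = (lconv (M₁ + M₂) M₃ (lconv M₁ M₂ ρ₁ ρ₂) ρ₃ h - (1 - s) * lconv (M₁ + M₂) M₃ (lconv M₁ M₂ ρ₁m ρ₂) ρ₃ h) / s := by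
    rw [← lconv3_merge_left M₁ M₂ M₃ ρ₁ ρ₂ ρ₃ ρ₁m ρ₁p s hs₁ h]; field_simp; ring
  have e₂ : lconv (M₁ + M₂) M₃ (lconv M₁ M₂ ρ₁ ρ₂p) ρ₃ h
      = (lconv (M₁ + M₂) M₃ (lconv M₁ M₂ ρ₁ ρ₂) ρ₃ h - (1 - s) * lconv (M₁ + M₂) M₃ (lconv M₁ M₂ ρ₁ ρ₂m) ρ₃ h) / s := by
    rw [← lconv3_merge_mid M₁ M₂ M₃ ρ₁ ρ₂ ρ₃ ρ₂m ρ₂p s hs₂ h]; field_simp; ring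
  have e₃ : lconv (M₁ + M₂) M₃ (lconv M₁ M₂ ρ₁ ρ₂) ρ₃p h
      = (lconv (M₁ + M₂) M₃ (lconv M₁ M₂ ρ₁ ρ₂) ρ₃ h - (1 - s) * lconv (M₁ + M₂) M₃ (lconv M₁ M₂ ρ₁ ρ₂) ρ₃m h) / s := by
    rw [← lconv3_merge_right M₁ M₂ M₃ ρ₁ ρ₂ ρ₃ ρ₃m ρ₃p s hs₃ h]; field_simp; ring
  rw [gate_apply _ a h, lconv3_gate_expand M₁ M₂ M₃ ρ₁ ρ₂ ρ₃ q q q h₁M h₂M h₃M h,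
    gate_apply (lconv (M₁ + M₂) M₃ (lconv M₁ M₂ ρ₁ ρ₂) ρ₃) (a * q) h,
    lconv3_gate_expand M₁ M₂ M₃ ρ₁ ρ₂ ρ₃ (a * q) (a * q) (a * q) h₁M h₂M h₃M h,
    lconv3_version_left M₁ M₂ M₃ ρ₁m ρ₂ ρ₃ _ h₂M h, lconv3_version_mid M₁ M₂ M₃ ρ₁ ρ₂m ρ₃ _ h₁M h,
    lconv3_version_right M₁ M₂ M₃ ρ₁ ρ₂ ρ₃m _ h,
    lconv3_version_left M₁ M₂ M₃ ρ₁p ρ₂ ρ₃ _ h₂M h, lconv3_version_mid M₁ M₂ M₃ ρ₁ ρ₂p ρ₃ _ h₁M h,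
    lconv3_version_right M₁ M₂ M₃ ρ₁ ρ₂ ρ₃p _ h, e₁, e₂, e₃]
  field_simp
  ring

/-- **the general weights sum to one.** [this work] -/
theorem tiedCore_general_weights_sum (q s a Rm₁ Rm₂ Rm₃ Rs₁ Rs₂ Rs₃ : ℝ) (hm : 1 - a * q ≠ 0)
    (hSig : (Rm₁ + s * Rs₁) + (Rm₂ + s * Rs₂) + (Rm₃ + s * Rs₃) ≠ 0) :
    (1 - a) * q * (2 - q) / (1 - a * q) + ((1 - q) / (1 - a * q)) ^ 2
      + ((1 - s) * (1 - q) * (1 - a) * (a * q * q) / ((1 - a * q) ^ 2 * ((Rm₁ + s * Rs₁) + (Rm₂ + s * Rs₂) + (Rm₃ + s * Rs₃))))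
          * (Rm₁ + Rm₂ + Rm₃)
      + ((s * (1 - q) * (1 - a) * (a * q * q)) / ((1 - a * q) ^ 2 * ((Rm₁ + s * Rs₁) + (Rm₂ + s * Rs₂) + (Rm₃ + s * Rs₃))))
          * ((Rm₁ + Rs₁) + (Rm₂ + Rs₂) + (Rm₃ + Rs₃)) = 1 := by
  field_simp
  ring

/-- **every version component has the target mean** `S = a·q·Σ` when `Rm`, `Rs` are the means: `Rᵢ + Rⱼ + τₖ·Rmₖ = S = Rᵢ + Rⱼ + tₖ·(Rmₖ + Rsₖ)`
(shown for `k = 3`; the other two are the same statement with the indices permuted). [this work] -/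
theorem tiedCore_general_means (q s a Rm₁ Rm₂ Rm₃ Rs₁ Rs₂ Rs₃ : ℝ) (hRm₃ : Rm₃ ≠ 0) (hRp₃ : Rm₃ + Rs₃ ≠ 0) :
    (Rm₁ + s * Rs₁) + (Rm₂ + s * Rs₂)
        + ((a * q * ((Rm₁ + s * Rs₁) + (Rm₂ + s * Rs₂) + (Rm₃ + s * Rs₃)) - (Rm₁ + s * Rs₁) - (Rm₂ + s * Rs₂)) / Rm₃) * Rm₃
      = a * q * ((Rm₁ + s * Rs₁) + (Rm₂ + s * Rs₂) + (Rm₃ + s * Rs₃))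
    ∧ (Rm₁ + s * Rs₁) + (Rm₂ + s * Rs₂)
        + ((a * q * ((Rm₁ + s * Rs₁) + (Rm₂ + s * Rs₂) + (Rm₃ + s * Rs₃)) - (Rm₁ + s * Rs₁) - (Rm₂ + s * Rs₂)) / (Rm₃ + Rs₃))
            * (Rm₃ + Rs₃)
      = a * q * ((Rm₁ + s * Rs₁) + (Rm₂ + s * Rs₂) + (Rm₃ + s * Rs₃)) := by
  constructor
  · field_simp
    ring
  · field_simp
    ring

end LawDec

end Quant

end Summit.CriticalPhenomena.PercolationContinuityZ3.Theorems
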